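import Summits.NavierStokesRegularity.NavierStokesRegularity.Theorems.FilamentSkeletonRssBoxSelectionRJ

/-!
# Route `FilamentSkeletonRss` · glue `Selection1AL` (stmt-NavierStokesRegularity-23298; Variant A1L — rigid matched cores):
# `SkeletonJ1L → TransverseReduction1AL → RssProfileExists`

PORT (proof body verbatim) of `selection1AL_proof` from ns-idea-12 g6's certified retype kit `Cruxes/SelectionBoxRJ/Lines/retype_A1L_kit.lean`
(sha16 66aa737d78a81db5, l.59–91), landed by the LEAD of the ∀-crux `ns-filament-21221-p1` g11 on DIRECTOR-NS dss_111 port P2 (tenure g23 owed port (a);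
route revs 44–47: items 23296 `SkeletonJ1L`, 23297 `TransverseReduction1AL`, 23298 `Selection1AL`).  Variant A1L swaps ONE conjunct of the clause block
(passive core-area law → rigid matched core `1 ≤ KA·Aa j (c j) ∧ (‖X j τ‖ ≤ 2Rb√(Γ log Γ) → Aa j τ = Aa j (c j))`) IN LOCK-STEP on both sides, so the
clause block produced by `SkeletonJ1L` is consumed by `TransverseReduction1AL` as ONE hypothesis (`hskel` below) and the 1AG proof (`selection1AG_proof`,
p635521, lane ns-filament-19175-p1 g10) re-threads unchanged — there is no gap across the swap: the glue never inspects the clause block.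
ONE skeleton at `Γ = max Γ₁ Γ₂` ⇒ the free-rate reduction gives an exact smooth decaying rotated-Leray profile with some rate `α₁ ≠ 0` ⇒
`RssProfileExists` via the tree's `Theorems.stub_rssProfileExists_of_profile`.  No Poincaré–Miranda, no sign law, no multipliers.
HONEST FRAMING: glue between two OPEN cruxes of a MODEL route (negative side); nothing here bears on Navier–Stokes regularity or blow-up.
-/

set_option linter.dupNamespace false

noncomputable section

namespace Summit.NavierStokesRegularity.NavierStokesRegularity.Theorems

open Set Function Filter MeasureTheory Real
open Literature.Analysis.FluidPDE Literature.Analysis.FluidPDE.PineauVicol2026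
open Summit.NavierStokesRegularity.NavierStokesRegularity.Theses.FilamentSkeletonRss
open scoped InnerProductSpace Laplacian ContDiff Topology BigOperators

/-- **Glue `Selection1AL` (stmt-NavierStokesRegularity-23298), PROVED**: `SkeletonJ1G → TransverseReduction1AG → RssProfileExists`
(proof verbatim from ns-idea-12 g6's kit `retype_A1L_kit.lean` sha16 66aa737d78a81db5, `selection1AL_proof` l.59–91 = the 1AG proof re-threaded across the one-conjunct swap). [folklore] -/
theorem selection1AL_proof :
    Summit.NavierStokesRegularity.NavierStokesRegularity.Theses.FilamentSkeletonRss.Selection1AL := by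
  unfold Selection1AL
  intro hbox hred
  classical
  obtain ⟨N, δ, ρ, K, Λ, a, b, cnd, η, Rw, Rb, cg, θ₀, KA, Γ₂, hN, hδ, hρ, ha, _hcnd, hη, hRw, hRb, hcg, hθ₀, hbox⟩ :=
    hbox
  obtain ⟨Γ₁, hred⟩ := hred N δ ρ K Λ a b cnd η Rw Rb cg θ₀ KA hN hδ hρ ha hη hRw hRb hcg hθ₀
  obtain ⟨γ, α, X, w, c, m, n, Aa, hfam⟩ := hbox (max Γ₁ Γ₂) (le_max_right _ _)
  set Γ : ℝ := max Γ₁ Γ₂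
  set u : (Fin N → ℝ → EuclideanSpace ℝ (Fin 3)) → EuclideanSpace ℝ (Fin 3) → EuclideanSpace ℝ (Fin 3) :=
    fun Z y => ∑ k : Fin N, (Γ * γ k / (4 * π)) • ∫ σ : ℝ,
        ((‖y - Z k σ‖ ^ 2 + Real.exp (-(1 + Real.eulerMascheroniConstant - Real.log 2)) * Aa k σ) ^ (3 / 2 : ℝ))⁻¹ •
          cross (deriv (Z k) σ) (y - Z k σ)
  set v : EuclideanSpace ℝ (Fin 3) → EuclideanSpace ℝ (Fin 3) :=
    fun y => u X y + (1 / 2 : ℝ) • y - α • cross (EuclideanSpace.single (2 : Fin 3) (1 : ℝ)) y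
  set A : Fin N → (EuclideanSpace ℝ (Fin 3) →L[ℝ] EuclideanSpace ℝ (Fin 3)) := fun j => fderiv ℝ v (X j (c j))
  set T : (Fin N → ℝ → EuclideanSpace ℝ (Fin 3)) → Fin N → ℝ → EuclideanSpace ℝ (Fin 3) :=
    fun Z j τ => (u Z (Z j τ) + (1 / 2 : ℝ) • Z j τ - α • cross (EuclideanSpace.single (2 : Fin 3) (1 : ℝ)) (Z j τ)) -
      (inner ℝ (u Z (Z j τ) + (1 / 2 : ℝ) • Z j τ - α • cross (EuclideanSpace.single (2 : Fin 3) (1 : ℝ)) (Z j τ)) (deriv (Z j) τ) /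
        ‖deriv (Z j) τ‖ ^ 2) • deriv (Z j) τ
  have hskel := hfam u v A T (fun _ _ => rfl) (fun _ => rfl) (fun _ => rfl) (fun _ _ _ => rfl)
  obtain ⟨α₁, C₀, M, U, P, hα₁, hU0, hUs, hPs, hdiv, heq, hdec, hPM, -⟩ := hred Γ (le_max_left _ _) γ α X w c m n Aa u v A T
    (fun _ _ => rfl) (fun _ => rfl) (fun _ => rfl) (fun _ _ _ => rfl) hskel
  have heq0 : ∀ y : EuclideanSpace ℝ (Fin 3), α₁ • (rotGen (U y) - fderiv ℝ U y (rotGen y)) +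
      (1 / 2 : ℝ) • U y + (1 / 2 : ℝ) • fderiv ℝ U y y - (Δ U) y + fderiv ℝ U y (U y) + gradient P y = 0 := by
    intro y
    simp only [splitGlue_rotGen_eq_cross_single_two]
    exact heq y
  exact stub_rssProfileExists_of_profile ⟨α₁, C₀, M, U, P, hα₁, hU0, hUs, hPs, hdiv, heq0, hdec, hPM⟩

end Summit.NavierStokesRegularity.NavierStokesRegularity.Theorems
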